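import Mathlib.AlgebraicGeometry.EllipticCurve.Affine.Point
import Mathlib.FieldTheory.IsAlgClosed.Basic
import Mathlib.RingTheory.MvPolynomial.Basic
import Mathlib.Algebra.MvPolynomial.PDeriv
import HarnessLib

/-!
# A polynomial vanishing on the affine points of an elliptic curve vanishes on them over every
# extension field

Topic `NumberTheory/EllipticCurves`; a proofs-only file (theorems only: no definitions, no named
facts).  Let `E` be an elliptic curve over an algebraically closed field `F` of characteristic `0`,
given by a Weierstrass equation `W`, and let `G ∈ F[x, y]` (`MvPolynomial (Fin 2) F`, variable
`0` is `x`, variable `1` is `y`).  If `G(x, y) = 0` at every affine point `(x, y) ∈ E(F)`, then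
`G` lies in the ideal generated by the Weierstrass polynomial, hence `G(x, y) = 0` at every affine
point of `E` over every extension field `M ⊇ F`
(`WeierstrassCurve.aeval_eq_zero_of_forall_eval_eq_zero`).  This is the Nullstellensatz for the
(absolutely irreducible) plane cubic, in the elementary form: divide `G` by the Weierstrass
polynomial, which is monic of degree `2` in `y` (`exists_eq_mul_weierstrass_add`:
`G = q · f_W + g₀(x) + y g₁(x)`), and observe that `g₀(x) + y g₁(x)` vanishes at the two points
`(x, y)`, `(x, -y - a₁x - a₃)` above all but finitely many `x` (those with
`4x³ + b₂x² + 2b₄x + b₆ ≠ 0`), so that `g₁` and then `g₀` have infinitely many roots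
(`eq_zero_of_forall_eval_add_mul_eval_eq_zero`).  Silverman, *AEC*, III.§2–3 (the coordinate
ring `F[x, y]/(f_W)` and its basis `1, y` over `F[x]`, proof of Prop. III.3.1 / Cor. III.2.3.1);
Fulton, *Algebraic Curves*, §1.7 (a polynomial vanishing on an irreducible plane curve is a
multiple of its equation).

It is used in the tree to transport polynomial identities that are known at the complex points of
a curve over a number field (obtained analytically, e.g. the multiplier identity `ψ^*ω' = k ω` of
`IsogenyRealPeriodProofs`) to its points over `p`-adic fields (file
`IsogenyPadicLinearTermProofs`, towards Milne, *ADT*, Thm. I.7.3).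

## References

* J. H. Silverman, *The Arithmetic of Elliptic Curves*, 2nd ed., GTM 106 (2009), III.§2 (proof of
  Cor. III.2.3.1: every `f ∈ K[x, y]/(f_W)` is `g₀(x) + y g₁(x)`), III.3.1. [SilvermanAEC2009]
* W. Fulton, *Algebraic Curves* (2008 ed.), §1.7, §6.? (irreducible plane curves).

## Design

Theorems only (D-0026).  The Weierstrass polynomial is written out as the `MvPolynomial`
`X₁² + a₁X₀X₁ + a₃X₁ - (X₀³ + a₂X₀² + a₄X₀ + a₆)` (Mathlib's `Affine.polynomial` lives in
`F[X][Y]`); one-variable polynomials `g(x)` are embedded by `Polynomial.aeval (X 0)`.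
-/

noncomputable section

open MvPolynomial

namespace WeierstrassCurve

universe u v

variable {F : Type u} [Field F]

/-- Evaluation of an embedded one-variable polynomial: `(g(X₀))(v) = g(v 0)`. [folklore] -/
theorem eval_polynomial_aeval_X_zero (g : Polynomial F) (v : Fin 2 → F) :
    MvPolynomial.eval v (Polynomial.aeval (X 0 : MvPolynomial (Fin 2) F) g) = g.eval (v 0) := by
  induction g using Polynomial.induction_on' with
  | add p q hp hq => rw [map_add, map_add, Polynomial.eval_add, hp, hq]
  | monomial n c =>
    rw [Polynomial.aeval_monomial, Polynomial.eval_monomial, map_mul, map_pow, eval_X,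
      MvPolynomial.algebraMap_eq, eval_C]

/-- The same over an `F`-algebra `M`: `aeval v (g(X₀)) = aeval (v 0) g`. [folklore] -/
theorem aeval_polynomial_aeval_X_zero {M : Type v} [CommRing M] [Algebra F M] (g : Polynomial F)
    (v : Fin 2 → M) :
    MvPolynomial.aeval v (Polynomial.aeval (X 0 : MvPolynomial (Fin 2) F) g) =
      Polynomial.aeval (v 0) g := by
  induction g using Polynomial.induction_on' with
  | add p q hp hq => rw [map_add, map_add, map_add, hp, hq]
  | monomial n c =>
    rw [Polynomial.aeval_monomial, Polynomial.aeval_monomial, map_mul, map_pow, aeval_X,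
      MvPolynomial.algebraMap_eq, aeval_C]

variable (W : WeierstrassCurve F)

/-- **Division by the Weierstrass polynomial**: every `G ∈ F[x, y]` is
`q · (y² + a₁xy + a₃y - x³ - a₂x² - a₄x - a₆) + g₀(x) + y · g₁(x)` with `g₀, g₁ ∈ F[x]`
(the Weierstrass polynomial is monic of degree `2` in `y`; Silverman, *AEC*, III.§2, proof of
Cor. 2.3.1). [cite: SilvermanAEC2009, III.§2 (proof of Cor. III.2.3.1)] -/
theorem exists_eq_mul_weierstrass_add (G : MvPolynomial (Fin 2) F) :
    ∃ (q : MvPolynomial (Fin 2) F) (g₀ g₁ : Polynomial F),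
      G = q * (X 1 ^ 2 + C W.a₁ * X 0 * X 1 + C W.a₃ * X 1 -
          (X 0 ^ 3 + C W.a₂ * X 0 ^ 2 + C W.a₄ * X 0 + C W.a₆)) +
        (Polynomial.aeval (X 0 : MvPolynomial (Fin 2) F) g₀ +
          X 1 * Polynomial.aeval (X 0 : MvPolynomial (Fin 2) F) g₁) := by
  set ι : Polynomial F →ₐ[F] MvPolynomial (Fin 2) F := Polynomial.aeval (X 0) with hι
  set f : MvPolynomial (Fin 2) F := X 1 ^ 2 + C W.a₁ * X 0 * X 1 + C W.a₃ * X 1 -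
    (X 0 ^ 3 + C W.a₂ * X 0 ^ 2 + C W.a₄ * X 0 + C W.a₆) with hf
  induction G using MvPolynomial.induction_on with
  | C c => exact ⟨0, Polynomial.C c, 0, by simp [hι]⟩
  | add G H ihG ihH =>
    obtain ⟨q, g₀, g₁, hG⟩ := ihG
    obtain ⟨q', g₀', g₁', hH⟩ := ihH
    refine ⟨q + q', g₀ + g₀', g₁ + g₁', ?_⟩
    rw [hG, hH, map_add, map_add]
    ring
  | mul_X G i ih =>
    obtain ⟨q, g₀, g₁, hG⟩ := ih
    fin_cases i
    · -- multiplication by `x`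
      refine ⟨q * X 0, g₀ * Polynomial.X, g₁ * Polynomial.X, ?_⟩
      have h0 : ι Polynomial.X = X 0 := by rw [hι, Polynomial.aeval_X]
      rw [hG, map_mul, map_mul, h0]
      simp only [Fin.zero_eta]
      ring
    · -- multiplication by `y`: `y² = f - a₁xy - a₃y + (x³ + a₂x² + a₄x + a₆)`
      refine ⟨q * X 1 + ι g₁,
        (Polynomial.X ^ 3 + Polynomial.C W.a₂ * Polynomial.X ^ 2 + Polynomial.C W.a₄ * Polynomial.X +
          Polynomial.C W.a₆) * g₁,
        g₀ - (Polynomial.C W.a₁ * Polynomial.X + Polynomial.C W.a₃) * g₁, ?_⟩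
      have hX : ι Polynomial.X = X 0 := by rw [hι, Polynomial.aeval_X]
      have hC : ∀ c : F, ι (Polynomial.C c) = C c := fun c => by rw [hι, Polynomial.aeval_C]; rfl
      rw [hG]
      simp only [map_mul, map_add, map_sub, map_pow, hX, hC, Fin.mk_one]
      rw [hf]
      ring

/-- **The remainder vanishes**: if `g₀(x) + y g₁(x) = 0` at every affine point of an elliptic
curve over an algebraically closed field of characteristic `0`, then `g₀ = g₁ = 0`.  Above each
`x ∈ F` lie the points `(x, y)` and `(x, -y - a₁x - a₃)`, distinct unless
`4x³ + b₂x² + 2b₄x + b₆ = 0` (finitely many `x`); where they are distinct,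
`(2y + a₁x + a₃) g₁(x) = 0` gives `g₁(x) = 0`, so `g₁` has infinitely many roots, and then so does
`g₀`. Silverman, *AEC*, III.§2 (`1, y` is a basis of `K[E]` over `K[x]`).
[cite: SilvermanAEC2009, III.§2 (proof of Cor. III.2.3.1)] -/
theorem eq_zero_of_forall_eval_add_mul_eval_eq_zero [IsAlgClosed F] [CharZero F] [W.IsElliptic]
    {g₀ g₁ : Polynomial F}
    (h : ∀ x y : F, W.toAffine.Nonsingular x y → g₀.eval x + y * g₁.eval x = 0) :
    g₀ = 0 ∧ g₁ = 0 := by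
  -- above every `x` there is a point
  have hpt : ∀ x : F, ∃ y : F, W.toAffine.Equation x y := by
    intro x
    obtain ⟨s, hs⟩ := IsAlgClosed.exists_eq_mul_self
      ((W.a₁ * x + W.a₃) ^ 2 + 4 * (x ^ 3 + W.a₂ * x ^ 2 + W.a₄ * x + W.a₆))
    set y : F := (-(W.a₁ * x + W.a₃) + s) / 2 with hy
    have h2 : (2 : F) ≠ 0 := two_ne_zero
    have hy2 : 2 * y = -(W.a₁ * x + W.a₃) + s := by rw [hy]; field_simp
    refine ⟨y, ?_⟩
    rw [WeierstrassCurve.Affine.equation_iff]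
    have h4 : (4 : F) * (y ^ 2 + W.a₁ * x * y + W.a₃ * y - (x ^ 3 + W.a₂ * x ^ 2 + W.a₄ * x + W.a₆)) = 0 := by
      rw [show (4 : F) * (y ^ 2 + W.a₁ * x * y + W.a₃ * y - (x ^ 3 + W.a₂ * x ^ 2 + W.a₄ * x + W.a₆)) =
        (2 * y) ^ 2 + 2 * (W.a₁ * x + W.a₃) * (2 * y) -
          4 * (x ^ 3 + W.a₂ * x ^ 2 + W.a₄ * x + W.a₆) by ring, hy2]
      linear_combination (-1 : F) * hs
    have h4' : (4 : F) ≠ 0 := by norm_num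
    exact sub_eq_zero.mp ((mul_eq_zero.mp h4).resolve_left h4')
  -- the exceptional `x`: roots of `4x³ + b₂x² + 2b₄x + b₆`
  set t : Polynomial F := Polynomial.C 4 * Polynomial.X ^ 3 + Polynomial.C W.b₂ * Polynomial.X ^ 2 +
    Polynomial.C (2 * W.b₄) * Polynomial.X + Polynomial.C W.b₆ with ht
  have ht0 : t ≠ 0 := by
    intro h0
    have hc : t.coeff 3 = 4 := by
      rw [ht]
      simp only [Polynomial.coeff_add, Polynomial.coeff_C_mul, Polynomial.coeff_X_pow,
        Polynomial.coeff_X, Polynomial.coeff_C]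
      norm_num
    rw [h0, Polynomial.coeff_zero] at hc
    exact (by norm_num : (4 : F) ≠ 0) hc.symm
  have hroot : ∀ x y : F, W.toAffine.Equation x y → 2 * y + W.a₁ * x + W.a₃ = 0 → t.IsRoot x := by
    intro x y hxy hy
    rw [WeierstrassCurve.Affine.equation_iff] at hxy
    rw [Polynomial.IsRoot, ht]
    simp only [Polynomial.eval_add, Polynomial.eval_mul, Polynomial.eval_C, Polynomial.eval_pow,
      Polynomial.eval_X, WeierstrassCurve.b₂, WeierstrassCurve.b₄, WeierstrassCurve.b₆]
    linear_combination (-4) * hxy + (2 * y + (W.a₁ * x + W.a₃)) * hy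
  -- `g₁` vanishes off the roots of `t`
  have hg₁ : ∀ x : F, ¬ t.IsRoot x → g₁.eval x = 0 := by
    intro x hx
    obtain ⟨y, hxy⟩ := hpt x
    have hxy' : W.toAffine.Equation x (W.toAffine.negY x y) :=
      (WeierstrassCurve.Affine.equation_neg x y).mpr hxy
    have h1 := h x y (WeierstrassCurve.Affine.equation_iff_nonsingular.mp hxy)
    have h2 := h x _ (WeierstrassCurve.Affine.equation_iff_nonsingular.mp hxy')
    have hne : 2 * y + W.a₁ * x + W.a₃ ≠ 0 := fun h0 => hx (hroot x y hxy h0)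
    have hdiff : (2 * y + W.a₁ * x + W.a₃) * g₁.eval x = 0 := by
      rw [WeierstrassCurve.Affine.negY] at h2
      linear_combination h1 - h2
    exact (mul_eq_zero.mp hdiff).resolve_left hne
  have hg₁0 : g₁ = 0 := by
    refine Polynomial.eq_zero_of_infinite_isRoot g₁ ?_
    have hsub : {x : F | t.IsRoot x}ᶜ ⊆ {x | g₁.IsRoot x} := fun x hx => hg₁ x hx
    exact ((Polynomial.finite_setOf_isRoot ht0).infinite_compl).mono hsub
  refine ⟨?_, hg₁0⟩
  refine Polynomial.eq_zero_of_infinite_isRoot g₀ ?_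
  have hall : ∀ x : F, g₀.IsRoot x := by
    intro x
    obtain ⟨y, hxy⟩ := hpt x
    have h1 := h x y (WeierstrassCurve.Affine.equation_iff_nonsingular.mp hxy)
    rw [hg₁0, Polynomial.eval_zero, mul_zero, add_zero] at h1
    exact h1
  have : {x : F | g₀.IsRoot x} = Set.univ := Set.eq_univ_of_forall hall
  rw [this]
  exact Set.infinite_univ

/-- **A polynomial vanishing on `E(F)` vanishes on `E(M)` for every field `M ⊇ F`** (`F`
algebraically closed of characteristic `0`, `E/F` elliptic): if `G(x, y) = 0` for all affine
points `(x, y) ∈ E(F)`, then `G(x, y) = 0` for all affine points of `E` over `M`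
(`G ≡ g₀(x) + y g₁(x)` modulo the Weierstrass polynomial with `g₀ = g₁ = 0`, and the Weierstrass
polynomial vanishes at the points of `E(M)`).  Silverman, *AEC*, III.§2–3; Fulton, *Algebraic
Curves*, §1.7. [cite: SilvermanAEC2009, III.§2 (proof of Cor. III.2.3.1)] -/
theorem aeval_eq_zero_of_forall_eval_eq_zero [IsAlgClosed F] [CharZero F] [W.IsElliptic]
    (G : MvPolynomial (Fin 2) F) (hG : ∀ x y : F, W.toAffine.Nonsingular x y → eval ![x, y] G = 0)
    {M : Type v} [Field M] [Algebra F M] {x y : M} (hxy : (W.baseChange M).toAffine.Equation x y) :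
    MvPolynomial.aeval ![x, y] G = 0 := by
  obtain ⟨q, g₀, g₁, hGq⟩ := W.exists_eq_mul_weierstrass_add G
  -- the remainder vanishes on `E(F)`
  have hrem : ∀ a b : F, W.toAffine.Nonsingular a b → g₀.eval a + b * g₁.eval a = 0 := by
    intro a b hab
    have h := hG a b hab
    have heq : b ^ 2 + W.a₁ * a * b + W.a₃ * b - (a ^ 3 + W.a₂ * a ^ 2 + W.a₄ * a + W.a₆) = 0 :=
      (WeierstrassCurve.Affine.equation_iff' a b).mp hab.1
    rw [hGq] at h
    simp only [map_add, map_mul, map_sub, map_pow, eval_X, eval_C, eval_polynomial_aeval_X_zero,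
      Matrix.cons_val_zero, Matrix.cons_val_one] at h
    rw [heq, mul_zero, zero_add] at h
    exact h
  obtain ⟨h₀, h₁⟩ := W.eq_zero_of_forall_eval_add_mul_eval_eq_zero hrem
  have heqM : y ^ 2 + algebraMap F M W.a₁ * x * y + algebraMap F M W.a₃ * y -
      (x ^ 3 + algebraMap F M W.a₂ * x ^ 2 + algebraMap F M W.a₄ * x + algebraMap F M W.a₆) = 0 := by
    have := (WeierstrassCurve.Affine.equation_iff' x y).mp hxy
    simpa only [WeierstrassCurve.baseChange, WeierstrassCurve.map_a₁, WeierstrassCurve.map_a₂,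
      WeierstrassCurve.map_a₃, WeierstrassCurve.map_a₄, WeierstrassCurve.map_a₆] using this
  rw [hGq, h₀, h₁]
  simp only [map_add, map_mul, map_sub, map_pow, aeval_X, aeval_C, map_zero,
    mul_zero, add_zero, Matrix.cons_val_zero, Matrix.cons_val_one]
  rw [heqM, mul_zero]

/-- Pointwise-equality form: two polynomials `G, H ∈ F[x, y]` agreeing on the affine points of
`E(F)` agree on the affine points of `E(M)`. [cite: SilvermanAEC2009, III.§2 (proof of Cor. III.2.3.1)] -/
theorem aeval_eq_aeval_of_forall_eval_eq [IsAlgClosed F] [CharZero F] [W.IsElliptic]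
    (G H : MvPolynomial (Fin 2) F)
    (hGH : ∀ x y : F, W.toAffine.Nonsingular x y → eval ![x, y] G = eval ![x, y] H)
    {M : Type v} [Field M] [Algebra F M] {x y : M} (hxy : (W.baseChange M).toAffine.Equation x y) :
    MvPolynomial.aeval ![x, y] G = MvPolynomial.aeval ![x, y] H := by
  rw [← sub_eq_zero, ← map_sub]
  exact W.aeval_eq_zero_of_forall_eval_eq_zero (G - H)
    (fun a b hab => by rw [map_sub, hGH a b hab, sub_self]) hxy

end WeierstrassCurve
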